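import Summits.CriticalPhenomena.PercolationContinuityZ3.Theses.PercTreeValue
import Summits.CriticalPhenomena.PercolationContinuityZ3.Theorems.PercTreeValueAssemblyViaDisjointCoexistence
import Summits.CriticalPhenomena.PercolationContinuityZ3.Theorems.PercTreeValueAssembly
import Summits.CriticalPhenomena.PercolationContinuityZ3.Theorems.PercTreeValueAssemblyViaThreePoint
import Summits.CriticalPhenomena.PercolationContinuityZ3.Theorems.PercTreeValueAssemblyViaLogConvexity
import Summits.CriticalPhenomena.PercolationContinuityZ3.Theorems.PercTreeValueConnectionPatternFactorisation

/-!
# Crux-strategist sketch — `PercTreeValue.TetrahedronLogConvexity` (stmt-CriticalPhenomena-7801)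

Typed content of the STRATEGY-CENSUS (`Cruxes/TetrahedronLogConvexity/STRATEGY-CENSUS.md`):

* `§ Decomposition`: the only typed split of the crux whose glue is provable today —
  `SiblingAmplitudeCrux` (pointer: any one of the route's three sibling cruxes, each of which already
  implies the conjunct by a landed assembly) and `AmplitudeGivenContinuity` (the residual: the sharp
  size-bias amplitude bound IN THE CONTINUOUS WORLD). `tetrahedronLogConvexity_of_subs` is the glue,
  proved sorry-free from landed theorems. NOT filed as a `route edit --split` (census: the residual is
  the whole crux minus `θ(p_c)=0`, false on the critical tree and undecided even in the solved planar
  sibling; a split whose hard half has no plan is a renaming, not a redirect).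
* `§ Strengthen`: `DoublingQuasiMonotonicity` — the one strengthening under which a certified finite
  computation could enter; recorded as a signature only (no engine: it is an RG-monotonicity statement).
* `§ Negation`: `crux_iff_continuity_and_residual` — the crux is EQUIVALENT to
  `PercolationContinuityZ3 ∧ AmplitudeGivenContinuity` (tree theorems), so a counterexample is either a
  jump (`¬ PercolationContinuityZ3`) or a continuous world with `liminf Φ₄ ≤ 1`.
-/

namespace Summit.CriticalPhenomena.PercolationContinuityZ3.Cruxes.TetrahedronLogConvexity.Strategist

open Summit.CriticalPhenomena.PercolationContinuityZ3.Theses.PercTreeValue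
open Summit.CriticalPhenomena.PercolationContinuityZ3.Theorems

/-- Piece 1 (pointer, kind support): one of the route's three sibling amplitude cruxes holds —
disjoint coexistence (rank 2), strict Harris (rank 3) or equilateral anti-factorisation (rank 4).
Each disjunct implies `θ(p_c) = 0` on `ℤ³` by a landed assembly (7803; 7806 ∘ 7802; 7804 ∘ 7802). -/
def SiblingAmplitudeCrux : Prop :=
  TetrahedronDisjointCoexistence ∨ TetrahedronHarrisGap ∨ EquilateralAntiFactorisation

/-- Piece 2 (the residual): the size-bias amplitude bound `Φ₄ ≥ 1 + δ` GIVEN continuity of the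
transition. Vacuously true in every jump world (so `LongRangeDiscontinuity` cannot bite it); false on
the critical regular tree (`Φ₄ ≡ 1` at the star configuration although `θ(p_c) = 0` there); its planar
analogue is undecided (4-point connectivity amplitudes of 2D percolation are not rigorously known). -/
def AmplitudeGivenContinuity : Prop :=
  _root_.PercolationContinuityZ3 → TetrahedronLogConvexity

/-- `SiblingAmplitudeCrux → θ(p_c) = 0`: case analysis over the three landed assemblies. -/
theorem percolationContinuityZ3_of_sibling (h : SiblingAmplitudeCrux) : _root_.PercolationContinuityZ3 := by
  rcases h with h | h | h
  · exact AssemblyViaDisjointCoexistence_proof h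
  · exact percTreeValue_assembly_proof connectionPatternFactorisation_proof h
  · exact assemblyViaThreePoint_proof connectionPatternFactorisation_proof h

/-- The split glue `Piece 1 → Piece 2 → crux`, sorry-free (this is what `--glue-by` would cite). -/
theorem tetrahedronLogConvexity_of_subs (h₁ : SiblingAmplitudeCrux) (h₂ : AmplitudeGivenContinuity) :
    TetrahedronLogConvexity :=
  h₂ (percolationContinuityZ3_of_sibling h₁)

/-- Negation bookkeeping: the crux is exactly "continuity ∧ residual" (so its counterexamples are
exactly: a jump, or a continuous world with `liminf_r Φ₄(T_r) ≤ 1`). -/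
theorem crux_iff_continuity_and_residual :
    TetrahedronLogConvexity ↔ (_root_.PercolationContinuityZ3 ∧ AmplitudeGivenContinuity) :=
  ⟨fun h => ⟨percTreeValue_assemblyViaLogConvexity_proof connectionPatternFactorisation_proof h, fun _ => h⟩,
   fun h => h.2 h.1⟩

/-- The four-point amplitude `Φ₄(r)` of the lattice tetrahedron `T_r` at `p_c(ℤ³)` (junk value when a
denominator vanishes; only its eventual behaviour is ever used). -/
noncomputable def Phi4 (r : ℕ) : ℝ :=
  (Literature.Probability.Percolation.bondPercolation (Literature.Probability.LatticeModels.zdGraph 3)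
      (Literature.Probability.Percolation.criticalProbI 3)).real
    (Literature.Probability.Percolation.openConn 0 ![(r : ℤ), (r : ℤ), 0] ∩
      Literature.Probability.Percolation.openConn 0 ![(r : ℤ), 0, (r : ℤ)] ∩
      Literature.Probability.Percolation.openConn 0 ![0, (r : ℤ), (r : ℤ)]) *
    Literature.Probability.Percolation.tau 3 (Literature.Probability.Percolation.criticalProbI 3) 0
      ![(r : ℤ), (r : ℤ), 0] /
  ((Literature.Probability.Percolation.bondPercolation (Literature.Probability.LatticeModels.zdGraph 3)
      (Literature.Probability.Percolation.criticalProbI 3)).real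
    (Literature.Probability.Percolation.openConn 0 ![(r : ℤ), (r : ℤ), 0] ∩
      Literature.Probability.Percolation.openConn 0 ![(r : ℤ), 0, (r : ℤ)]) *
   (Literature.Probability.Percolation.bondPercolation (Literature.Probability.LatticeModels.zdGraph 3)
      (Literature.Probability.Percolation.criticalProbI 3)).real
    (Literature.Probability.Percolation.openConn 0 ![(r : ℤ), (r : ℤ), 0] ∩
      Literature.Probability.Percolation.openConn 0 ![0, (r : ℤ), (r : ℤ)]))

/-- `§ Strengthen`, candidate S⁺ (signature only): DOUBLING QUASI-MONOTONICITY of the amplitude —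
`Φ₄(2r) ≥ Φ₄(r) − ε_r` with a summable defect. Together with ONE certified value `Φ₄(r₁) > 1 + Σ ε`
it would give the crux along the dyadic subsequence (and a companion comparison `Φ₄(s) ≥ Φ₄(r) − ε_r`
for `r ≤ s ≤ 2r` the full crux). It is a renormalisation-group monotonicity statement for a
four-point amplitude: no engine in any dimension; numerically `Φ₄(r)` DEcreases towards `Φ₄* ≈ 1.18`
(1.27 → 1.16 for r = 3 → 15), so the defects are genuinely needed. Recorded, not filed. -/
def DoublingQuasiMonotonicity : Prop :=
  ∃ ε : ℕ → ℝ, Summable ε ∧ ∃ r₀ : ℕ, ∀ r : ℕ, r₀ ≤ r → Phi4 r - ε r ≤ Phi4 (2 * r)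

end Summit.CriticalPhenomena.PercolationContinuityZ3.Cruxes.TetrahedronLogConvexity.Strategist
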